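import Summits.CriticalPhenomena.PercolationContinuityZ3.Theorems.PercNearOneGluingNoHeavyLowerTailKnQuestion8CoefficientwisePendant
import Summits.CriticalPhenomena.PercolationContinuityZ3.Theorems.PercNearOneGluingNoHeavyLowerTailKnQuestion8CoefficientwiseMirror
import HarnessLib

/-!
# Conjecture SUPER for a pendant conditioning vertex

Support file (`--supports stmt-CriticalPhenomena-4575`, closed), prover `prim-cplus-coupling` (gen 28).  No definitions, no notations, no named
facts, no sorries; standard axioms.  Memo `prim-cplus-coupling/A5-COUPLING-gen28.md` §2.1.

SUPER (memo §1; file …CoefficientwiseMirror): for `x ≠ z` and mirror test functions `ψ₁, ψ₂` (antisymmetric, monotone in the first argument),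
`0 ≤ Σ_{s : z ∉ C_x(s), z ∉ C_x(sᶜ)} ψ₁(C_x s, C_x sᶜ)·ψ₂(C_x s, C_x sᶜ)`.  This file proves it when `z` is PENDANT (one edge `e₀ = {z,v}`), exactly as
prim-lf-2's `cwpa_pendant_symm` (the case `ψᵢ a b = fᵢ a − fᵢ b`): resolving the colour of `e₀` gives `2·Σ_{t ⊆ E∖e₀ : v ∉ C_x(t)} ψ₁ψ₂ ≥ 0` on `G − e₀`,
which is `mirror_offCluster_nonneg` (transported to the sub-multigraph) with avoided set `{v}`.
* `Coefficientwise.mirror_offCluster_nonneg_sub` — the one-sided mirror theorem on the colourings of an edge subset `E'`;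
* `Coefficientwise.super_pendant` — SUPER for pendant `z`.
[cite: KozmaNitzan2024, Questions 8–9 (§5.5 p. 36) (context: the Question-8 pocket covariance programme)]
-/

namespace Summit.CriticalPhenomena.PercolationContinuityZ3.Theorems

open Finset Literature.Probability.Percolation

namespace Coefficientwise

variable {ι V : Type*} [DecidableEq ι]

open Classical in
/-- **One-sided mirror positivity on a sub-multigraph.**  For an edge set `E'`, a vertex `x`, a vertex set `A` and mirror test functions `ψ₁, ψ₂`,
`0 ≤ Σ_{t ⊆ E' : A ∩ C_x(t) = ∅} ψ₁(C_x t, C_x(E' ∖ t))·ψ₂(C_x t, C_x(E' ∖ t))` — `mirror_offCluster_nonneg` for the multigraph with edge set `E'`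
(transported along `{i // i ∈ E'}`, verbatim as prim-lf-2's `offCluster_twoColouring_nonneg_sub`). [this work] -/
theorem mirror_offCluster_nonneg_sub (ends : ι → Sym2 V) (E' : Finset ι) (x : V) (A : Set V) (ψ₁ ψ₂ : Set V → Set V → ℝ)
    (h₁a : ∀ a b, ψ₁ a b = -ψ₁ b a) (h₁m : ∀ a a' b, a ⊆ a' → ψ₁ a b ≤ ψ₁ a' b)
    (h₂a : ∀ a b, ψ₂ a b = -ψ₂ b a) (h₂m : ∀ a a' b, a ⊆ a' → ψ₂ a b ≤ ψ₂ a' b) :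
    0 ≤ ∑ t ∈ E'.powerset.filter (fun t : Finset ι => ∀ a ∈ A, a ∉ openCluster (ends '' (↑t : Set ι)) x),
      ψ₁ (openCluster (ends '' (↑t : Set ι)) x) (openCluster (ends '' (↑(E' \ t) : Set ι)) x) *
        ψ₂ (openCluster (ends '' (↑t : Set ι)) x) (openCluster (ends '' (↑(E' \ t) : Set ι)) x) := by
  set emb : {i // i ∈ E'} ↪ ι := Function.Embedding.subtype _ with hemb
  have key := mirror_offCluster_nonneg (ends ∘ Subtype.val : {i // i ∈ E'} → Sym2 V) x A ψ₁ ψ₂ h₁a h₁m h₂a h₂m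
  have map_compl : ∀ t : Finset {i // i ∈ E'}, (tᶜ).map emb = E' \ t.map emb := by
    intro t
    ext i
    simp only [Finset.mem_map, Finset.mem_compl, Finset.mem_sdiff, hemb, Function.Embedding.coe_subtype]
    constructor
    · rintro ⟨⟨j, hj⟩, hjt, rfl⟩
      exact ⟨hj, fun ⟨⟨k, hk⟩, hkt, hkj⟩ => hjt (by cases hkj; exact hkt)⟩
    · rintro ⟨hiE, hnot⟩
      exact ⟨⟨i, hiE⟩, fun hit => hnot ⟨⟨i, hiE⟩, hit, rfl⟩, rfl⟩
  have map_sub : ∀ t : Finset {i // i ∈ E'}, t.map emb ⊆ E' := by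
    intro t i hi
    obtain ⟨⟨j, hj⟩, _, rfl⟩ := Finset.mem_map.mp hi
    exact hj
  refine key.trans_eq ?_
  refine Finset.sum_bij' (fun t _ => t.map emb) (fun t _ => t.subtype (· ∈ E')) ?_ ?_ ?_ ?_ ?_
  · intro t ht
    rw [Finset.mem_filter] at ht ⊢
    refine ⟨Finset.mem_powerset.mpr (map_sub t), ?_⟩
    rw [← image_map_subtype]; exact ht.2
  · intro t ht
    rw [Finset.mem_filter] at ht ⊢
    refine ⟨Finset.mem_univ _, ?_⟩
    have hsub : t ⊆ E' := Finset.mem_powerset.mp ht.1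
    rw [image_map_subtype, Finset.subtype_map_of_mem (fun i hi => hsub hi)]
    exact ht.2
  · intro t _
    ext ⟨i, hi⟩
    rw [Finset.mem_subtype, Finset.mem_map]
    constructor
    · rintro ⟨⟨j, hj⟩, hjt, hji⟩
      have hji' : j = i := by simpa [hemb] using hji
      subst hji'
      exact hjt
    · intro h
      exact ⟨⟨i, hi⟩, h, by simp [hemb]⟩
  · intro t ht
    have hsub : t ⊆ E' := Finset.mem_powerset.mp (Finset.mem_filter.mp ht).1
    exact Finset.subtype_map_of_mem (fun i hi => hsub hi)
  · intro t _
    rw [image_map_subtype, image_map_subtype ends E' (tᶜ), map_compl]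

variable [Fintype ι]

open Classical in
/-- **SUPER for a pendant conditioning vertex.**  If `z ≠ x` is a leaf of the multigraph (`e₀ = {z, v}` its only edge, `z ≠ v`), then for mirror test
functions `ψ₁, ψ₂` (antisymmetric, monotone in the first argument),
  `0 ≤ Σ_{s : z ∉ C_x(s), z ∉ C_x(sᶜ)} ψ₁(C_x s, C_x sᶜ)·ψ₂(C_x s, C_x sᶜ)`.
Proof as `cwpa_pendant_symm`: resolve the colour of `e₀`; both halves equal `Σ_{t ⊆ E∖e₀ : v ∉ C_x(t)} ψ₁ψ₂` on `G − e₀` (colour swap and antisymmetry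
of both `ψ`'s), which is `mirror_offCluster_nonneg_sub` with `A = {v}`. [this work] -/
theorem super_pendant (ends : ι → Sym2 V) {z v x : V} {e₀ : ι} (he₀ : ends e₀ = s(z, v))
    (hpend : ∀ i, z ∈ ends i → i = e₀) (hzx : z ≠ x) (hzv : z ≠ v) (ψ₁ ψ₂ : Set V → Set V → ℝ)
    (h₁a : ∀ a b, ψ₁ a b = -ψ₁ b a) (h₁m : ∀ a a' b, a ⊆ a' → ψ₁ a b ≤ ψ₁ a' b)
    (h₂a : ∀ a b, ψ₂ a b = -ψ₂ b a) (h₂m : ∀ a a' b, a ⊆ a' → ψ₂ a b ≤ ψ₂ a' b) :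
    0 ≤ ∑ s ∈ univ.filter (fun s : Finset ι => z ∉ openCluster (ends '' (↑s : Set ι)) x ∧ z ∉ openCluster (ends '' (↑(sᶜ) : Set ι)) x),
      ψ₁ (openCluster (ends '' (↑s : Set ι)) x) (openCluster (ends '' (↑(sᶜ) : Set ι)) x) *
        ψ₂ (openCluster (ends '' (↑s : Set ι)) x) (openCluster (ends '' (↑(sᶜ) : Set ι)) x) := by
  set K : Finset ι → Set V := fun s => openCluster (ends '' (↑s : Set ι)) x with hK
  set E' : Finset ι := univ.erase e₀ with hE'
  set Φ' : Finset ι → ℝ := fun t => ψ₁ (K t) (K (E' \ t)) * ψ₂ (K t) (K (E' \ t)) with hΦ'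
  change 0 ≤ ∑ s ∈ univ.filter (fun s : Finset ι => z ∉ K s ∧ z ∉ K sᶜ), ψ₁ (K s) (K sᶜ) * ψ₂ (K s) (K sᶜ)
  have he₀E' : e₀ ∉ E' := fun h => (Finset.mem_erase.mp h).1 rfl
  have huniv : (univ : Finset (Finset ι)) = (insert e₀ E').powerset := by
    rw [hE', Finset.insert_erase (Finset.mem_univ e₀), Finset.powerset_univ]
  -- the half-sum on `G − e₀`
  have hbase : 0 ≤ ∑ t ∈ E'.powerset.filter (fun t : Finset ι => v ∉ K t), Φ' t := by
    have := mirror_offCluster_nonneg_sub ends E' x ({v} : Set V) ψ₁ ψ₂ h₁a h₁m h₂a h₂m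
    simpa [hK, hΦ'] using this
  have compl_of_sub : ∀ t, t ⊆ E' → tᶜ = insert e₀ (E' \ t) := by
    intro t ht
    ext i
    simp only [Finset.mem_compl, Finset.mem_insert, Finset.mem_sdiff, hE', Finset.mem_erase, Finset.mem_univ, and_true]
    constructor
    · intro hi
      by_cases hie : i = e₀
      · exact Or.inl hie
      · exact Or.inr ⟨hie, hi⟩
    · rintro (rfl | ⟨_, hi⟩)
      · exact fun h => he₀E' (ht h)
      · exact hi
  have compl_insert_of_sub : ∀ t, t ⊆ E' → (insert e₀ t)ᶜ = E' \ t := by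
    intro t ht
    ext i
    simp only [Finset.mem_compl, Finset.mem_insert, Finset.mem_sdiff, hE', Finset.mem_erase, Finset.mem_univ, and_true, not_or]
  have notin_of_sub : ∀ t, t ⊆ E' → e₀ ∉ t := fun t ht h => he₀E' (ht h)
  have notin_sdiff : ∀ t, e₀ ∉ E' \ t := fun t h => he₀E' (Finset.mem_sdiff.mp h).1
  rw [Finset.sum_filter, huniv, Finset.sum_powerset_insert he₀E']
  have h1 : ∑ t ∈ E'.powerset, (if z ∉ K t ∧ z ∉ K tᶜ then ψ₁ (K t) (K tᶜ) * ψ₂ (K t) (K tᶜ) else 0) =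
      ∑ t ∈ E'.powerset, (if v ∉ K (E' \ t) then Φ' t else 0) := by
    refine Finset.sum_congr rfl fun t ht => ?_
    have hsub : t ⊆ E' := Finset.mem_powerset.mp ht
    have hzt : z ∉ K t := leaf_not_mem_openCluster ends hpend hzx (notin_of_sub t hsub)
    rw [compl_of_sub t hsub]
    by_cases hv : v ∈ K (E' \ t)
    · have hz : z ∈ K (insert e₀ (E' \ t)) := (leaf_mem_openCluster_insert_iff ends he₀ hpend hzx hzv (notin_sdiff t)).mpr hv
      simp [hz, hv]
    · have hKc : K (insert e₀ (E' \ t)) = K (E' \ t) := openCluster_insert_pendant ends he₀ hpend hzx (notin_sdiff t) hv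
      have hzc : z ∉ K (E' \ t) := leaf_not_mem_openCluster ends hpend hzx (notin_sdiff t)
      rw [hKc]
      simp [hzt, hzc, hv, hΦ']
  have h2 : ∑ t ∈ E'.powerset, (if z ∉ K (insert e₀ t) ∧ z ∉ K (insert e₀ t)ᶜ then
        ψ₁ (K (insert e₀ t)) (K (insert e₀ t)ᶜ) * ψ₂ (K (insert e₀ t)) (K (insert e₀ t)ᶜ) else 0) =
      ∑ t ∈ E'.powerset, (if v ∉ K t then Φ' t else 0) := by
    refine Finset.sum_congr rfl fun t ht => ?_
    have hsub : t ⊆ E' := Finset.mem_powerset.mp ht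
    rw [compl_insert_of_sub t hsub]
    have hzc : z ∉ K (E' \ t) := leaf_not_mem_openCluster ends hpend hzx (notin_sdiff t)
    by_cases hv : v ∈ K t
    · have hz : z ∈ K (insert e₀ t) := (leaf_mem_openCluster_insert_iff ends he₀ hpend hzx hzv (notin_of_sub t hsub)).mpr hv
      simp [hz, hv]
    · have hKi : K (insert e₀ t) = K t := openCluster_insert_pendant ends he₀ hpend hzx (notin_of_sub t hsub) hv
      have hzt : z ∉ K t := leaf_not_mem_openCluster ends hpend hzx (notin_of_sub t hsub)
      rw [hKi]
      simp [hzt, hzc, hv, hΦ']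
  have h3 : ∑ t ∈ E'.powerset, (if v ∉ K (E' \ t) then Φ' t else 0) = ∑ t ∈ E'.powerset, (if v ∉ K t then Φ' t else 0) := by
    refine Finset.sum_bij' (fun t _ => E' \ t) (fun t _ => E' \ t) ?_ ?_ ?_ ?_ ?_
    · intro t _; exact Finset.mem_powerset.mpr Finset.sdiff_subset
    · intro t _; exact Finset.mem_powerset.mpr Finset.sdiff_subset
    · intro t ht; exact Finset.sdiff_sdiff_eq_self (Finset.mem_powerset.mp ht)
    · intro t ht; exact Finset.sdiff_sdiff_eq_self (Finset.mem_powerset.mp ht)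
    · intro t ht
      have hsub : t ⊆ E' := Finset.mem_powerset.mp ht
      have hΦsym : Φ' (E' \ t) = Φ' t := by
        simp only [hΦ', Finset.sdiff_sdiff_eq_self hsub]
        rw [h₁a (K (E' \ t)) (K t), h₂a (K (E' \ t)) (K t)]; ring
      rw [hΦsym]
  rw [h1, h2, h3, ← Finset.sum_filter]
  linarith [hbase]

end Coefficientwise

end Summit.CriticalPhenomena.PercolationContinuityZ3.Theorems
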